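import Summits.HubbardSuperconductivity.HubbardSuperconductivity.Theorems.AnisotropyChordTransferFibre3Hole2BondGap
import Summits.HubbardSuperconductivity.HubbardSuperconductivity.Theorems.AnisotropyChordTransferFibre3Hole2Green
import Summits.HubbardSuperconductivity.HubbardSuperconductivity.Theorems.AnisotropyChordTransferFibre3TwoHoleGapReduce

/-!
# Route `AnisotropyChord` / H0 rotor rung: HOLE₂ per-`L` by the CHANNEL CHECK — three Green values per `L` (kernel checker + soundness)

With the theorem of channels (`…Fibre3Hole2BondGap.twoHoleGap_of_channels`: `aKer(2,0) ≤ ½ ∧ 2aKer(1,1) − aKer(2,0) ≤ ½` at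
`λ = 2g` ⇒ `TwoHoleGap L g`) a per-`L` certificate of HOLE₂(.75) needs only the THREE torus Green values `G̃_g(0,0)`, `G̃_g(2,0)`,
`G̃_g(1,1)` at `g = g_L` (g3's fixed-point `gFix L / 2^60 ∈ [¾ε₁, ε₁)`), each an `O(V)` interval sum already provided, with its
enclosure proof, by g3's `…Fibre3Hole2Check.greenIv` / `…Fibre3Hole2Green.mem_greenW`:
* `chanCheckWith` / `chanCheck L : Bool` — `checkParams L` (g3) and the two integer comparisons
  `hi G̃(0,0) − lo G̃(2,0) ≤ D` and `hi G̃(0,0) − 2·lo G̃(1,1) + hi G̃(2,0) ≤ D` (walk units: `2aKer(2,0) ≤ 1`, `4aKer(1,1) − 2aKer(2,0) ≤ 1`);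
* ★ `twoHoleGap_of_chanCheck`: `chanCheck L = true ⇒ TwoHoleGap L (3/4·eps1 L)` (channels at `g_L`, then p1's `twoHoleGap_mono`).
Cost `O(L²)` integer interval operations per `L` (no pair loop, no Green table, no linear algebra); the kernel facts
`chanCheck L = true` for `37 ≤ L ≤ 63` are in `…Fibre3Hole2ChanL*`; `L ≥ 64` is analytic (`…Fibre3Hole2Large`).
Prover seat `hubbard-h0-rotor-p3` g4; helper for stmt-HubbardSuperconductivity-19089 (`--supports`, helper class).
WHAT THIS IS NOT: nothing here proves superconductivity in the Hubbard model (rotor TARGET as worded stays FALSE, g15 verdict);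
a checker for ONE hypothesis (HOLE₂) of ONE conditional reduction (rung 19089). Tree imports only; no sorry, no axioms.
-/

set_option linter.dupNamespace false
set_option autoImplicit false

namespace Summit.HubbardSuperconductivity.HubbardSuperconductivity.Theorems.AnisotropyChord.Transfer.Fibre3

namespace Hole2

open scoped BigOperators

/-! ## Soundness -/

/-- `0 < g_L` from `0 < gFix L`. [folklore] -/
theorem gR_pos {L : ℕ} (h : 0 < gFix L) : 0 < gR L := by
  unfold gR
  exact div_pos (by exact_mod_cast h) D_pos

/-- reading a fixed-point upper comparison in `ℝ`: `mem x I`, `mem y J`, `I.2 − J.1 ≤ D` ⇒ `x − y ≤ 1`. [folklore] -/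
theorem sub_le_one_of_mem {x y : ℝ} {I J : Iv} (hx : mem x I) (hy : mem y J) (h : I.2 - J.1 ≤ D) : x - y ≤ 1 := by
  obtain ⟨_, hx2⟩ := hx
  obtain ⟨hy1, _⟩ := hy
  have hD := D_pos
  have h' : ((I.2 : ℤ) : ℝ) - ((J.1 : ℤ) : ℝ) ≤ ((D : ℤ) : ℝ) := by exact_mod_cast h
  nlinarith

/-- the three-term version: `mem x I`, `mem y J`, `mem w K`, `I.2 − 2J.1 + K.2 ≤ D` ⇒ `x − 2y + w ≤ 1`. [folklore] -/
theorem sub_two_add_le_one_of_mem {x y w : ℝ} {I J K : Iv} (hx : mem x I) (hy : mem y J) (hw : mem w K)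
    (h : I.2 - 2 * J.1 + K.2 ≤ D) : x - 2 * y + w ≤ 1 := by
  obtain ⟨_, hx2⟩ := hx
  obtain ⟨hy1, _⟩ := hy
  obtain ⟨_, hw2⟩ := hw
  have hD := D_pos
  have h' : ((I.2 : ℤ) : ℝ) - 2 * ((J.1 : ℤ) : ℝ) + ((K.2 : ℤ) : ℝ) ≤ ((D : ℤ) : ℝ) := by exact_mod_cast h
  nlinarith

/-- ★★ SOUNDNESS OF THE CHANNEL CHECK: `chanCheck L = true ⇒ TwoHoleGap L (3/4·ε₁)` — HOLE₂(.75) at `L` from three Green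
values (theorem of channels at `g_L ∈ [¾ε₁, ε₁)`, then monotonicity in `g`). [folklore] -/
theorem twoHoleGap_of_chanCheck (L : ℕ) [NeZero L] (h : chanCheck L = true) : TwoHoleGap L (3 / 4 * eps1 L) := by
  unfold chanCheck at h
  rw [Bool.and_eq_true] at h
  obtain ⟨hpar, hch⟩ := h
  unfold checkParams at hpar
  simp only [Bool.and_eq_true, decide_eq_true_eq] at hpar
  obtain ⟨⟨⟨⟨hL, _⟩, hg0⟩, hglt⟩, hpos⟩ := hpar
  unfold chanCheckWith at hch
  simp only [Bool.and_eq_true, decide_eq_true_eq] at hch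
  obtain ⟨hc1, hc2⟩ := hch
  -- the three enclosures (g3's `mem_greenW`)
  set P20 : Tor L := ((((2 : ℕ)) : ZMod L), (((0 : ℕ)) : ZMod L)) with hP20
  set P11 : Tor L := ((((1 : ℕ)) : ZMod L), (((1 : ℕ)) : ZMod L)) with hP11
  have m00 := mem_greenW L hL hpos (show 0 < L by omega) (show 0 < L by omega)
  have m20 : mem (TwoHoleBS.greenW L (gR L) P20).re (greenIv L (cosTab L) (einvTab L (cosTab L) (gFix L)) 2 0) :=
    mem_greenW L hL hpos (show 2 < L by omega) (show 0 < L by omega)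
  have m11 : mem (TwoHoleBS.greenW L (gR L) P11).re (greenIv L (cosTab L) (einvTab L (cosTab L) (gFix L)) 1 1) :=
    mem_greenW L hL hpos (show 1 < L by omega) (show 1 < L by omega)
  have e00 : TwoHoleBS.greenW L (gR L) ((((0 : ℕ) : ZMod L), (((0 : ℕ) : ZMod L))) : Tor L)
      = TwoHoleBS.greenW L (gR L) 0 := by
    congr 1; ext <;> simp
  rw [e00] at m00
  set G0 : ℝ := (TwoHoleBS.greenW L (gR L) 0).re with hG0
  set G20 : ℝ := (TwoHoleBS.greenW L (gR L) P20).re with hG20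
  set G11 : ℝ := (TwoHoleBS.greenW L (gR L) P11).re with hG11
  -- the two channel inequalities in `ℝ`
  have d1 : G0 - G20 ≤ 1 := sub_le_one_of_mem m00 m20 hc1
  have d2 : G0 - 2 * G11 + G20 ≤ 1 := sub_two_add_le_one_of_mem m00 m11 m20 hc2
  have a20 : G0 - G20 = 2 * aKer L (2 * gR L) P20 := TwoHoleBS.greenW_diff_re L (gR L) P20
  have a11 : G0 - G11 = 2 * aKer L (2 * gR L) P11 := TwoHoleBS.greenW_diff_re L (gR L) P11
  have h1 : aKer L (2 * gR L) P20 ≤ 1 / 2 := by linarith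
  have h2 : 2 * aKer L (2 * gR L) P11 - aKer L (2 * gR L) P20 ≤ 1 / 2 := by linarith
  exact twoHoleGap_mono L (gFix_ge L hL)
    (TwoHoleBS.twoHoleGap_of_channels_nat L (by omega) (gR_pos hg0) (gFix_lt L hL hglt) h1 h2)

end Hole2

end Summit.HubbardSuperconductivity.HubbardSuperconductivity.Theorems.AnisotropyChord.Transfer.Fibre3
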